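import Mathlib
import HarnessLib
import Literature.Analysis.FluidPDE.ClassicalSolution
import Literature.Analysis.FluidPDE.Vorticity
import Summits.NavierStokesRegularity.NavierStokesRegularity.Theorems.QuarterLogPincerBeadCensusDefs
import Summits.NavierStokesRegularity.NavierStokesRegularity.Theorems.QuarterLogPincerBeadCensusKernel
import Summits.NavierStokesRegularity.NavierStokesRegularity.Theorems.QuarterLogPincerCubicRungDefs
import Summits.NavierStokesRegularity.NavierStokesRegularity.Theorems.QuarterLogPincerThinCascadeDefs
import Summits.NavierStokesRegularity.NavierStokesRegularity.Theorems.QuarterLogPincerTypeIQuantSubcubicExpStubUniformScaledEnergy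
import Summits.NavierStokesRegularity.NavierStokesRegularity.Theorems.QuarterLogPincerTypeIQuantSubcubicExpFrameTools
import Summits.NavierStokesRegularity.NavierStokesRegularity.Theorems.QuarterLogPincerTypeIQuantSubcubicExpZoomEnergyA
import Summits.NavierStokesRegularity.NavierStokesRegularity.Theorems.QuarterLogPincerTypeIQuantSubcubicExpRescaleTools
import Summits.NavierStokesRegularity.NavierStokesRegularity.Theorems.QuarterLogPincerTypeIQuantSubcubicExpUnitScaleTools
import Summits.NavierStokesRegularity.NavierStokesRegularity.Theorems.QuarterLogPincerHelmholtzCentreDefs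
import Summits.NavierStokesRegularity.NavierStokesRegularity.Theorems.QuarterLogPincerHelmholtzCentreShellKernel
import Summits.NavierStokesRegularity.NavierStokesRegularity.Theorems.QuarterLogPincerFlatChainDefs
import Summits.NavierStokesRegularity.NavierStokesRegularity.Theorems.QuarterLogPincerFlatChainTypeIEpoch
import Literature.Analysis.FluidPDE.BarkerPrangeLocalizedSmoothingBounds
import Literature.Analysis.FluidPDE.BarkerPrangeConcentrationProofs
import Literature.Analysis.FluidPDE.BackwardHeatPointwise
import Literature.Analysis.FluidPDE.AncientWeakL3BackwardLiouvilleAssembly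
import Literature.Analysis.FluidPDE.LocalEnergySolutionsOn
import Literature.Analysis.FluidPDE.LocalLerayExistence
import Literature.Analysis.FluidPDE.BoundedMildWeakL3LocalEnergySolution
import Literature.Analysis.FluidPDE.BoundedMildWeakL3RieszPressure
import Literature.Analysis.FluidPDE.KatoLocalLerayPressureProofs
import Literature.Analysis.FluidPDE.VeryWeakToDistributional
import Literature.Analysis.FluidPDE.VeryWeakToDistributionalFour
import Literature.Analysis.FluidPDE.ClassicalBoundedWeak
import Literature.Analysis.FluidPDE.MildSolution
import Literature.Analysis.SingularIntegrals.HardyLittlewoodSobolev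
import Literature.Analysis.FluidPDE.VorticityCalculus
import Literature.Analysis.FluidPDE.BiotSavartWeakLp
import Summits.NavierStokesRegularity.NavierStokesRegularity.Theorems.QuarterLogPincerFlatChainSliceDefs

/-!
# Route `QuarterLogPincer`, crux `TypeIQuantSubcubicExp` (stmt-NavierStokesRegularity-24077), line `flat_chain` —
# §10a (part A): the `E²` / uloc clauses of P and the slice-field frame (classical, rate, bound, continuity), the author's proofs VERBATIM

For the Navier–Stokes rescaling `v = sliceField u x t* r` of a crux frame: `sliceField_lintegral_unitBall_le`, `sliceField_eLpNorm_unitBall_le`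
(I1 clause A transported), `sliceField_memE2`, `sliceField_eq_rescale_shift`, `sliceField_classical`, `sliceField_rate`, `sliceField_bound`,
`sliceField_continuousOn`.  Over `…FlatChainSliceDefs`.
HONEST FRAME: ports of the author's kernel-checked in-file proofs about HYPOTHETICAL Type-I classical solutions; no census node,
⟨24077⟩, W7 or Navier–Stokes regularity is proved (OPEN).  pub-ns-dss typer (g39), `--supports stmt-NavierStokesRegularity-24077`;
texts by ns-idea-7 (g14), workfile `Cruxes/TypeIQuantSubcubicExp/Lines/flat_chain.lean` v1.12 (sha f4adcfe506ba), VERBATIM.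
-/

set_option linter.dupNamespace false

namespace Summit.NavierStokesRegularity.NavierStokesRegularity.Cruxes.TypeIQuantSubcubicExp.FlatChain

noncomputable section

open MeasureTheory Set Metric
open scoped ENNReal NNReal Classical
open Literature.Analysis Literature.Analysis.FluidPDE
open Summit.NavierStokesRegularity.NavierStokesRegularity.Cruxes.TypeIQuantSubcubicExp.BeadCensus
open Summit.NavierStokesRegularity.NavierStokesRegularity.Cruxes.TypeIQuantSubcubicExp.CubicRung

/-! ### §10a (v1.7) The `E²` and uloc clauses of P — PROVED (I1 clause A transported by `lintegral_sq_ball_zoom`;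
square-integrability by `rescale_lintegral_sq`; continuity from classical smoothness) -/

section PClauses

open Summit.NavierStokesRegularity.NavierStokesRegularity.Cruxes.TypeIQuantSubcubicExp.ThinCascade
  (TaoFrame UniformScaledEnergy stub_uniformScaledEnergy)
open Summit.NavierStokesRegularity.NavierStokesRegularity.Theorems.ThinCascade
  (lintegral_sq_ball_zoom rescale_lintegral_sq rescale_rate exists_lintegral_sq_le_of_taoFrame frame_restrict typeI_restrict)

/-- `∫ ‖f‖ₑ² = (eLpNorm f 2)²`. [folklore] -/
theorem lintegral_enorm_sq_eq_eLpNorm_sq' {α : Type*} [MeasurableSpace α] (μ : Measure α)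
    (f : α → EuclideanSpace ℝ (Fin 3)) :
    ∫⁻ x, ‖f x‖ₑ ^ 2 ∂μ = eLpNorm f 2 μ ^ 2 := by
  rw [eLpNorm_eq_lintegral_rpow_enorm_toReal two_ne_zero ENNReal.ofNat_ne_top, ENNReal.toReal_ofNat,
    ← ENNReal.rpow_natCast, ← ENNReal.rpow_mul, show (1 / (2 : ℝ) * ((2 : ℕ) : ℝ)) = 1 by norm_num,
    ENNReal.rpow_one]
  exact lintegral_congr fun x => by
    rw [show (2 : ℝ) = ((2 : ℕ) : ℝ) by norm_num, ENNReal.rpow_natCast]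

/-- **uloc clause of P.**  Under the crux frame with the Type-I rate, the unit-ball energies of the rescaled slice
`sliceField u x t* r 0` are bounded by the I1 constant: `∫_{B(x₁,1)} ‖v(0)‖² ≤ C₊(M)` for every `x₁`. -/
theorem sliceField_lintegral_unitBall_le {M C T τ : ℝ}
    (hC : ∀ (T τ : ℝ) (u : ℝ → EuclideanSpace ℝ (Fin 3) → EuclideanSpace ℝ (Fin 3))
      (p : ℝ → EuclideanSpace ℝ (Fin 3) → ℝ), TaoFrame T u p → 0 < τ →
      (∀ t ∈ Icc 0 T, ∀ x : EuclideanSpace ℝ (Fin 3), ‖u t x‖ ≤ M * (T + τ - t) ^ (-(1 / 2 : ℝ))) →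
      ∀ (x : EuclideanSpace ℝ (Fin 3)) (r : ℝ), 0 < r → r ^ 2 ≤ T →
        (∀ t ∈ Icc (T - r ^ 2) T,
          ∫⁻ y in ball x r, ENNReal.ofReal (‖u t y‖ ^ 2) ≤ ENNReal.ofReal (C * r)) ∧
        (∫⁻ t in Icc (T - r ^ 2) T, ∫⁻ y in ball x r,
          ENNReal.ofReal (‖fderiv ℝ (u t) y‖ ^ 2) ≤ ENNReal.ofReal (C * r)) ∧
        (∫⁻ t in Icc (T - r ^ 2) T, ∫⁻ y in ball x r,
          ENNReal.ofReal (|p t y - ⨍ z in ball x r, p t z| ^ (3 / 2 : ℝ)) ≤ ENNReal.ofReal (C * r ^ 2)))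
    {u : ℝ → EuclideanSpace ℝ (Fin 3) → EuclideanSpace ℝ (Fin 3)} {p : ℝ → EuclideanSpace ℝ (Fin 3) → ℝ}
    (hfr : TaoFrame T u p) (hτ : 0 < τ)
    (hrate : ∀ t ∈ Icc 0 T, ∀ x : EuclideanSpace ℝ (Fin 3), ‖u t x‖ ≤ M * (T + τ - t) ^ (-(1 / 2 : ℝ)))
    (x : EuclideanSpace ℝ (Fin 3)) {tstar r : ℝ} (hr : 0 < r) (ht0 : 0 ≤ tstar) (htT : tstar ≤ T)
    (hrT : r ^ 2 ≤ T) (x₁ : EuclideanSpace ℝ (Fin 3)) :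
    ∫⁻ y in ball x₁ 1, ‖sliceField u x tstar r 0 y‖ₑ ^ 2 ≤ ENNReal.ofReal (max C 0) := by
  have hr2 : 0 < r ^ 2 := by positivity
  -- the auxiliary vertex `T' = min (t* + r²) T`
  set T' : ℝ := min (tstar + r ^ 2) T with hT'
  have hT'T : T' ≤ T := min_le_right _ _
  have htT' : tstar ≤ T' := le_min (by linarith) htT
  have hrT' : r ^ 2 ≤ T' := le_min (by linarith) hrT
  have hT'0 : 0 < T' := lt_of_lt_of_le hr2 hrT'
  have hwin : tstar ∈ Icc (T' - r ^ 2) T' := ⟨by rw [hT']; have := min_le_left (tstar + r ^ 2) T; linarith, htT'⟩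
  have hfr' : TaoFrame T' u p := frame_restrict hfr hT'0 hT'T
  have hrate' := typeI_restrict hrate hT'T
  have hτ' : 0 < T - T' + τ := by linarith
  have hA := (hC T' (T - T' + τ) u p hfr' hτ' hrate' (x + r • x₁) r hr hrT').1 tstar hwin
  -- transport to the rescaled slice
  have hz := lintegral_sq_ball_zoom hr tstar x u 0 x₁ 1
  rw [mul_one, mul_zero, add_zero] at hz
  have hconv : ∫⁻ y in ball (x + r • x₁) r, ‖u tstar y‖ₑ ^ 2
      = ∫⁻ y in ball (x + r • x₁) r, ENNReal.ofReal (‖u tstar y‖ ^ 2) := by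
    refine lintegral_congr fun y => ?_
    rw [ENNReal.ofReal_pow (norm_nonneg _), ofReal_norm]
  have hr0 : ENNReal.ofReal r ≠ 0 := (ENNReal.ofReal_pos.2 hr).ne'
  calc ∫⁻ y in ball x₁ 1, ‖sliceField u x tstar r 0 y‖ₑ ^ 2
      = (ENNReal.ofReal r)⁻¹ * ∫⁻ y in ball (x + r • x₁) r, ‖u tstar y‖ₑ ^ 2 := hz
    _ ≤ (ENNReal.ofReal r)⁻¹ * ENNReal.ofReal (max C 0 * r) := by
        rw [hconv]
        refine mul_le_mul' le_rfl (hA.trans (ENNReal.ofReal_le_ofReal ?_))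
        exact mul_le_mul_of_nonneg_right (le_max_left _ _) hr.le
    _ = ENNReal.ofReal (max C 0) := by
        rw [ENNReal.ofReal_mul (le_max_right _ _), mul_comm (ENNReal.ofReal (max C 0)), ← mul_assoc,
          ENNReal.inv_mul_cancel hr0 ENNReal.ofReal_ne_top, one_mul]

/-- **uloc clause of P in `eLpNorm` form**: `‖v(0)‖_{L²(B(x₁,1))} ≤ (C₊(M))^{1/2}`. -/
theorem sliceField_eLpNorm_unitBall_le {M C T τ : ℝ}
    (hC : ∀ (T τ : ℝ) (u : ℝ → EuclideanSpace ℝ (Fin 3) → EuclideanSpace ℝ (Fin 3))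
      (p : ℝ → EuclideanSpace ℝ (Fin 3) → ℝ), TaoFrame T u p → 0 < τ →
      (∀ t ∈ Icc 0 T, ∀ x : EuclideanSpace ℝ (Fin 3), ‖u t x‖ ≤ M * (T + τ - t) ^ (-(1 / 2 : ℝ))) →
      ∀ (x : EuclideanSpace ℝ (Fin 3)) (r : ℝ), 0 < r → r ^ 2 ≤ T →
        (∀ t ∈ Icc (T - r ^ 2) T,
          ∫⁻ y in ball x r, ENNReal.ofReal (‖u t y‖ ^ 2) ≤ ENNReal.ofReal (C * r)) ∧
        (∫⁻ t in Icc (T - r ^ 2) T, ∫⁻ y in ball x r,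
          ENNReal.ofReal (‖fderiv ℝ (u t) y‖ ^ 2) ≤ ENNReal.ofReal (C * r)) ∧
        (∫⁻ t in Icc (T - r ^ 2) T, ∫⁻ y in ball x r,
          ENNReal.ofReal (|p t y - ⨍ z in ball x r, p t z| ^ (3 / 2 : ℝ)) ≤ ENNReal.ofReal (C * r ^ 2)))
    {u : ℝ → EuclideanSpace ℝ (Fin 3) → EuclideanSpace ℝ (Fin 3)} {p : ℝ → EuclideanSpace ℝ (Fin 3) → ℝ}
    (hfr : TaoFrame T u p) (hτ : 0 < τ)
    (hrate : ∀ t ∈ Icc 0 T, ∀ x : EuclideanSpace ℝ (Fin 3), ‖u t x‖ ≤ M * (T + τ - t) ^ (-(1 / 2 : ℝ)))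
    (x : EuclideanSpace ℝ (Fin 3)) {tstar r : ℝ} (hr : 0 < r) (ht0 : 0 ≤ tstar) (htT : tstar ≤ T)
    (hrT : r ^ 2 ≤ T) (x₁ : EuclideanSpace ℝ (Fin 3)) :
    eLpNorm (sliceField u x tstar r 0) 2 (volume.restrict (ball x₁ 1))
      ≤ ENNReal.ofReal ((max C 0) ^ (1 / 2 : ℝ)) := by
  have h := sliceField_lintegral_unitBall_le hC hfr hτ hrate x hr ht0 htT hrT x₁
  rw [lintegral_enorm_sq_eq_eLpNorm_sq'] at h
  have h2 : eLpNorm (sliceField u x tstar r 0) 2 (volume.restrict (ball x₁ 1))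
      = (eLpNorm (sliceField u x tstar r 0) 2 (volume.restrict (ball x₁ 1)) ^ 2) ^ (1 / 2 : ℝ) := by
    rw [← ENNReal.rpow_natCast, ← ENNReal.rpow_mul]; norm_num
  rw [h2, ← ENNReal.ofReal_rpow_of_nonneg (le_max_right _ _) (by norm_num : (0 : ℝ) ≤ 1 / 2)]
  exact ENNReal.rpow_le_rpow h (by norm_num)

/-- **`E²` clause of P.**  The rescaled slice `v(0) = sliceField u x t* r 0` of a crux frame lies in `E²`
(it is continuous and square integrable: `∫ ‖v(0)‖² = r⁻¹ ∫ ‖u(t*)‖² < ∞`). -/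
theorem sliceField_memE2 {T : ℝ}
    {u : ℝ → EuclideanSpace ℝ (Fin 3) → EuclideanSpace ℝ (Fin 3)} {p : ℝ → EuclideanSpace ℝ (Fin 3) → ℝ}
    (hfr : TaoFrame T u p) (x : EuclideanSpace ℝ (Fin 3)) {tstar r : ℝ} (hr : 0 < r) (ht0 : 0 ≤ tstar)
    (htT : tstar ≤ T) : MemE2 (sliceField u x tstar r 0) := by
  have hr2 : 0 < r ^ 2 := by positivity
  -- continuity of the slice
  have hts : tstar ∈ Icc 0 T := ⟨ht0, htT⟩
  have hcont : Continuous (u tstar) := (hfr.1.smooth_velocity.contDiff_slice hts).continuous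
  have hcontv : Continuous (sliceField u x tstar r 0) := by
    have e : sliceField u x tstar r 0 = fun y => r • u tstar (x + r • y) := by
      funext y; rw [sliceField_apply, mul_zero, add_zero]
    rw [e]
    exact (hcont.comp (continuous_const.add (continuous_id.const_smul r))).const_smul r
  -- square integrability via the tree's `rescale_lintegral_sq` at rescaled time `t*/r²`
  obtain ⟨E₀, hE₀, hE⟩ := exists_lintegral_sq_le_of_taoFrame hfr
  obtain ⟨E₁, hE₁, hE1⟩ := rescale_lintegral_sq hr x hE₀ hE
  have hs : tstar / r ^ 2 ∈ Icc 0 (T / r ^ 2) :=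
    ⟨div_nonneg ht0 hr2.le, div_le_div_of_nonneg_right htT hr2.le⟩
  have e0 : sliceField u x tstar r 0 = (r • stPull (r ^ 2) r 0 x u) (tstar / r ^ 2) := by
    funext y
    have ht : tstar + r ^ 2 * 0 = 0 + r ^ 2 * (tstar / r ^ 2) := by
      rw [mul_zero, add_zero, zero_add, mul_div_cancel₀ _ hr2.ne']
    rw [sliceField_apply, smul_stPull_apply, ht]
  have hfin : ∫⁻ y, ‖sliceField u x tstar r 0 y‖ₑ ^ 2 < ⊤ := by
    rw [e0]; exact lt_of_le_of_lt (hE1 _ hs) hE₁.lt_top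
  have hmem : MemLp (sliceField u x tstar r 0) 2 volume := by
    refine ⟨hcontv.aestronglyMeasurable, ?_⟩
    rw [lintegral_enorm_sq_eq_eLpNorm_sq'] at hfin
    by_contra htop
    rw [not_lt, top_le_iff] at htop
    rw [htop, ENNReal.top_pow two_ne_zero] at hfin
    exact lt_irrefl _ hfin
  exact memE2_of_memLp hmem le_rfl ENNReal.ofNat_ne_top


/-- The slice field is the origin-`0` rescaling read at the shifted time `t*/r² + σ` — so every origin-`0` tool of the
`ThinCascade` kit (`rescale_classical`, `rescale_rate`, `rescale_lintegral_sq`) applies to it. -/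
theorem sliceField_eq_rescale_shift (u : ℝ → EuclideanSpace ℝ (Fin 3) → EuclideanSpace ℝ (Fin 3))
    (x : EuclideanSpace ℝ (Fin 3)) {tstar r : ℝ} (hr : 0 < r) (σ : ℝ) :
    sliceField u x tstar r σ = (r • stPull (r ^ 2) r 0 x u) (tstar / r ^ 2 + σ) := by
  have hr2 : (r ^ 2 : ℝ) ≠ 0 := by positivity
  funext y
  have ht : tstar + r ^ 2 * σ = 0 + r ^ 2 * (tstar / r ^ 2 + σ) := by
    rw [zero_add, mul_add, mul_div_cancel₀ _ hr2]
  rw [sliceField_apply, smul_stPull_apply, ht]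

/-- **The rescaled pair is a classical solution on `[0, S]`** (`ν = 1`, zero force) whenever the window
`[t*, t* + S r²]` lies in `[0, T]`: `(sliceField u x t* r, r² • stPull (r²) r t* x p)`. [folklore] -/
theorem sliceField_classical {T : ℝ}
    {u : ℝ → EuclideanSpace ℝ (Fin 3) → EuclideanSpace ℝ (Fin 3)} {p : ℝ → EuclideanSpace ℝ (Fin 3) → ℝ}
    (hcl : IsClassicalNSSolutionOn (Icc 0 T) 1 0 u p) (x : EuclideanSpace ℝ (Fin 3)) {tstar r S : ℝ}
    (hr : 0 < r) (hS : 0 < S) (ht0 : 0 ≤ tstar) (hwin : tstar + S * r ^ 2 ≤ T) :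
    IsClassicalNSSolutionOn (Icc 0 S) 1 0 (sliceField u x tstar r) (r ^ 2 • stPull (r ^ 2) r tstar x p) := by
  have hr2 : 0 < r ^ 2 := by positivity
  have key := hcl.stRescale (α := r) (β := r ^ 2) (γ := r) hr hr (by ring) tstar x
  have hν : r * (1 : ℝ) / r = 1 := by field_simp
  rw [hν, smul_stPull_zero] at key
  have hsub : Icc 0 S ⊆ (fun s => tstar + r ^ 2 * s) ⁻¹' Icc 0 T := by
    intro s hs
    simp only [mem_preimage, mem_Icc]
    exact ⟨by nlinarith [hs.1], by nlinarith [hs.2]⟩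
  exact key.mono hsub (uniqueDiffOn_Icc hS)

/-- **The Type-I rate of the slice field** (scale covariance): for `t* + r²σ ∈ [0, T]`,
`‖v(σ, y)‖ ≤ M ((T + τ − t*)/r² − σ)^{-1/2}`. [folklore] -/
theorem sliceField_rate {M T τ : ℝ} {u : ℝ → EuclideanSpace ℝ (Fin 3) → EuclideanSpace ℝ (Fin 3)}
    (hrate : ∀ t ∈ Icc 0 T, ∀ y, ‖u t y‖ ≤ M * (T + τ - t) ^ (-(1 / 2 : ℝ))) (hτ : 0 < τ)
    (x : EuclideanSpace ℝ (Fin 3)) {tstar r : ℝ} (hr : 0 < r) {σ : ℝ} (h0 : 0 ≤ tstar + r ^ 2 * σ)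
    (hT : tstar + r ^ 2 * σ ≤ T) (y : EuclideanSpace ℝ (Fin 3)) :
    ‖sliceField u x tstar r σ y‖ ≤ M * ((T + τ - tstar) / r ^ 2 - σ) ^ (-(1 / 2 : ℝ)) := by
  have hr2 : 0 < r ^ 2 := by positivity
  have hs : tstar / r ^ 2 + σ ∈ Icc 0 (T / r ^ 2) := by
    constructor
    · rw [show tstar / r ^ 2 + σ = (tstar + r ^ 2 * σ) / r ^ 2 by field_simp]
      exact div_nonneg h0 hr2.le
    · rw [show tstar / r ^ 2 + σ = (tstar + r ^ 2 * σ) / r ^ 2 by field_simp]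
      exact div_le_div_of_nonneg_right hT hr2.le
  have h := rescale_rate hr hτ x hrate _ hs y
  rw [sliceField_eq_rescale_shift u x hr σ]
  have e : T / r ^ 2 + τ / r ^ 2 - (tstar / r ^ 2 + σ) = (T + τ - tstar) / r ^ 2 - σ := by
    field_simp
    ring
  rw [e] at h
  exact h

/-- **A uniform bound for the slice field on a window inside `[0,T]`**: `‖v(σ,y)‖ ≤ M r τ^{-1/2}`. [folklore] -/
theorem sliceField_bound {M T τ : ℝ} {u : ℝ → EuclideanSpace ℝ (Fin 3) → EuclideanSpace ℝ (Fin 3)}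
    (hrate : ∀ t ∈ Icc 0 T, ∀ y, ‖u t y‖ ≤ M * (T + τ - t) ^ (-(1 / 2 : ℝ))) (hτ : 0 < τ)
    (x : EuclideanSpace ℝ (Fin 3)) {tstar r S : ℝ} (hr : 0 < r) (ht0 : 0 ≤ tstar) (hwin : tstar + S * r ^ 2 ≤ T) :
    ∀ σ ∈ Icc 0 S, ∀ y, ‖sliceField u x tstar r σ y‖ ≤ M * r * τ ^ (-(1 / 2 : ℝ)) := by
  intro σ hσ y
  have hr2 : 0 < r ^ 2 := by positivity
  have ht : tstar + r ^ 2 * σ ∈ Icc 0 T := ⟨by nlinarith [hσ.1], by nlinarith [hσ.2]⟩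
  have h := hrate _ ht (x + r • y)
  have hM : 0 ≤ M := by
    have h1 := hrate _ ht (x + r • y)
    have hpos : 0 < (T + τ - (tstar + r ^ 2 * σ)) ^ (-(1 / 2 : ℝ)) := Real.rpow_pos_of_pos (by linarith [ht.2]) _
    nlinarith [norm_nonneg (u (tstar + r ^ 2 * σ) (x + r • y))]
  rw [sliceField_apply, norm_smul, Real.norm_of_nonneg hr.le]
  have hτle : (T + τ - (tstar + r ^ 2 * σ)) ^ (-(1 / 2 : ℝ)) ≤ τ ^ (-(1 / 2 : ℝ)) :=
    Real.rpow_le_rpow_of_nonpos hτ (by linarith [ht.2]) (by norm_num)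
  calc r * ‖u (tstar + r ^ 2 * σ) (x + r • y)‖ ≤ r * (M * (T + τ - (tstar + r ^ 2 * σ)) ^ (-(1 / 2 : ℝ))) :=
        mul_le_mul_of_nonneg_left h hr.le
    _ ≤ r * (M * τ ^ (-(1 / 2 : ℝ))) := mul_le_mul_of_nonneg_left (mul_le_mul_of_nonneg_left hτle hM) hr.le
    _ = M * r * τ ^ (-(1 / 2 : ℝ)) := by ring

/-- **Joint continuity of the slice field** on `[0,S] × ℝ³`. [folklore] -/
theorem sliceField_continuousOn {T : ℝ}
    {u : ℝ → EuclideanSpace ℝ (Fin 3) → EuclideanSpace ℝ (Fin 3)} {p : ℝ → EuclideanSpace ℝ (Fin 3) → ℝ}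
    (hcl : IsClassicalNSSolutionOn (Icc 0 T) 1 0 u p) (x : EuclideanSpace ℝ (Fin 3)) {tstar r S : ℝ}
    (hr : 0 < r) (hS : 0 < S) (ht0 : 0 ≤ tstar) (hwin : tstar + S * r ^ 2 ≤ T) :
    ContinuousOn (Function.uncurry (sliceField u x tstar r)) (Icc 0 S ×ˢ univ) :=
  (sliceField_classical hcl x hr hS ht0 hwin).smooth_velocity.continuousOn

end PClauses


end

end Summit.NavierStokesRegularity.NavierStokesRegularity.Cruxes.TypeIQuantSubcubicExp.FlatChain
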